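/-
Cell b2b-lgcu-borel (gen 20).  VALUE = THEOREM (a decidable verdict on hypothetical witnesses of the crux),
NOT summit progress; the crux item `SubgroupIdentityDesigns` (stmt-MatrixMultiplication-14079) stays open.
-/
import Mathlib
import Summits.MatrixMultiplication.MatrixMultiplication.Theorems.SubgroupIdentityDesigns.Negative.SemiregularLaw

/-!
# `p = 11`: no bi-semiregular level-one witness in any dimension `m ≥ 3`

Route `LevelGradedCohnUmans`, crux `SubgroupIdentityDesigns` (stmt-MatrixMultiplication-14079), cells
`(m, k) = (m, 1)` at the prime `p = 11`; report `run/shared/lean/b2b/levelgraded-cu/ORACLE-g20.md` §G20-3.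
VALUE = THEOREM, NOT summit progress; the crux item is untouched and remains open.

`SemiregularLaw.no_biSemiregular_3_11` decided the single cell `(3, 11)`.  The same two laws
(`SemiregularLaw.law_right`, `law_left`: `z (x + y + b − 2) ≤ 10 b²`, `x (z + y + b − 2) ≤ 10 b²`,
`b = (11^m − 1)/10`) against the master floor `xyz ≥ 10 b³ − 3 b² + 3 b + 1` (`LevelOneFloorAll`) decide
the WHOLE COLUMN `p = 11`: with `u = min (x, z)` they force `xyz ≤ 10 b² u − u³ − (b − 2) u²`, whose
maximum is `≈ 0.938 · 10 b³ < 10 b³ − 3 b² + 3 b + 1` as soon as `b ≥ 42` (here `b ≥ 133`).  So for every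
`m ≥ 3` and every `−2 < ε ≤ 1` a level-one witness in `GL_m(𝔽_11)` cannot have both end members
semiregular on `𝔽_11^m ∖ 0` (`no_biSemiregular_eleven`).  (At `p ≥ 13` the same bound is `≥ 1.05 ×` the
floor, so the law alone decides nothing there; `m = 2` is the closed `(2, 1)` cell.)

Sorry-free; standard axioms.
-/

set_option linter.dupNamespace false

noncomputable section

open scoped BigOperators Classical Matrix LinearAlgebra.Projectivization

namespace Summit.MatrixMultiplication.MatrixMultiplication.Theorems.SubgroupIdentityDesigns.Negative
namespace SemiregularEleven

open Summit.MatrixMultiplication.MatrixMultiplication.Theorems.LieRankDesigns.Negative (GLm Mat budget)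
open Literature.Barriers.MatrixMultiplication (SubgroupTPP)
open SemiregularLaw (law_right law_left)
open PackingBridge (exists_test)

/-- The two-variable polynomial core (`b = A + 1 ≥ 133`, `w = y − 1`): `z (x + w) + z A ≤ 10 b²`,
`x ≤ z` and `x (w + 1) z + 3 b² ≥ 10 b³ + 3 b + 1` are incompatible.  Certificate:
`(25 x − 38 b)² (1900 x + 7694 b) ≥ 0`, `x² ≤ 10 b²` and `b ≥ 133`. -/
theorem arith_core_all {x w z A : ℤ} (hx : 1 ≤ x) (hw : 0 ≤ w) (hxz : x ≤ z) (hA : 132 ≤ A)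
    (hR : (x + w) * z + z * A ≤ 10 * (A + 1) ^ 2)
    (hV : 10 * (A + 1) ^ 3 + 3 * (A + 1) + 1 ≤ x * (w + 1) * z + 3 * (A + 1) ^ 2) : False := by
  have hz : 0 ≤ z := by linarith
  have h6 : x * x ≤ x * z := mul_le_mul_of_nonneg_left hxz (by linarith)
  have hxx : x * x ≤ 10 * (A + 1) ^ 2 := by
    nlinarith [h6, mul_nonneg hw hz, mul_nonneg hz (by linarith : (0 : ℤ) ≤ A)]
  have h1 := mul_nonneg (sq_nonneg (25 * x - 38 * (A + 1)))
    (by linarith : (0 : ℤ) ≤ 1900 * x + 7694 * (A + 1))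
  have h2 := mul_nonneg (by linarith : (0 : ℤ) ≤ A + 1)
    (by linarith : (0 : ℤ) ≤ 10 * (A + 1) ^ 2 - x * x)
  have h3 := mul_nonneg (by linarith : (0 : ℤ) ≤ A + 1 - 133) (sq_nonneg (A + 1))
  have h4 : x * ((x + w) * z + z * A) ≤ x * (10 * (A + 1) ^ 2) :=
    mul_le_mul_of_nonneg_left hR (by linarith)
  have h5 : x * x * x ≤ x * x * z := mul_le_mul_of_nonneg_left hxz (by positivity)
  have h7 : x * x * (A - 1) ≤ x * z * (A - 1) := mul_le_mul_of_nonneg_right h6 (by linarith)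
  nlinarith [h1, h2, h3, h4, h5, h7, hV, hxx]

/-- **NO BI-SEMIREGULAR LEVEL-ONE WITNESS AT `p = 11` IN ANY DIMENSION `m ≥ 3`**, for any
`−2 < ε ≤ 1`: a subgroup-TPP triple of `GL_m(𝔽_11)` with a level-one identity design beating the
budget at exponent `2 + ε` cannot have both end members `H₁`, `H₃` semiregular on `𝔽_11^m ∖ 0`. -/
theorem no_biSemiregular_eleven [Fact (Nat.Prime 11)] {m : ℕ} (hm3 : 3 ≤ m) {ε : ℝ} (hε : -2 < ε)
    (hε1 : ε ≤ 1) {H₁ H₂ H₃ : Subgroup (GLm 11 m)} (htpp : SubgroupTPP H₁ H₂ H₃)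
    (hdes : ∃ c : Mat 11 m → ℂ, (∀ M, 1 < M.rank → c M = 0) ∧
      (∑ M, c M * ZMod.stdAddChar (Matrix.trace (M * ((1 : GLm 11 m) : Mat 11 m)))) = 1 ∧
      ∀ a ∈ H₁, ∀ b ∈ H₂, ∀ g ∈ H₃, a * b * g ≠ 1 →
        (∑ M, c M * ZMod.stdAddChar (Matrix.trace (M * ((a * b * g : GLm 11 m) : Mat 11 m)))) = 0)
    (hlt : budget 11 m 1 (2 + ε) <
      ((Nat.card H₁ * Nat.card H₂ * Nat.card H₃ : ℕ) : ℝ) ^ ((2 + ε) / 3))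
    (hsr₁ : ∀ k : H₁, ∀ v : Fin m → ZMod 11, v ≠ 0 → k • v = v → k = 1)
    (hsr₃ : ∀ k : H₃, ∀ v : Fin m → ZMod 11, v ≠ 0 → k • v = v → k = 1) : False := by
  obtain ⟨l, rfl⟩ : ∃ l, m = 1 + l := ⟨m - 1, by omega⟩
  have hl : 2 ≤ l := by omega
  obtain ⟨f, hf, h1, h0⟩ := exists_test hdes
  have hm : 1 ≤ 1 + l := by omega
  have hR := law_right hm htpp hf h1 h0 le_rfl hsr₃
  have hL := law_left hm htpp hf h1 h0 le_rfl hsr₁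
  have hfl := LevelOneFloorAll.volume_gt_floor_nat (p := 11) (l := l) (by omega) hε hε1 hlt
  have hcard := LevelOneDim.card_proj_mul (p := 11) (m := 1 + l)
  have hP : 11 ^ 3 ≤ 11 ^ (1 + l) := Nat.pow_le_pow_right (by norm_num) (by omega)
  clear hlt hdes hf h0
  have hx1 : 1 ≤ Nat.card H₁ := Nat.card_pos
  have hy1 : 1 ≤ Nat.card H₂ := Nat.card_pos
  have hz1 : 1 ≤ Nat.card H₃ := Nat.card_pos
  set x := Nat.card H₁
  set y := Nat.card H₂
  set z := Nat.card H₃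
  set B := Nat.card (ℙ (ZMod 11) (Fin (1 + l) → ZMod 11))
  set P := 11 ^ (1 + l)
  clear_value x y z B P
  have hb : (P - 1) / (11 - 1) = B := by omega
  rw [hb] at hfl
  norm_num at hR hL hfl hP
  have hB : 133 ≤ B := by omega
  obtain ⟨w, rfl⟩ : ∃ w, y = w + 1 := ⟨y - 1, by omega⟩
  obtain ⟨A, rfl⟩ : ∃ A, B = A + 1 := ⟨B - 1, by omega⟩
  simp only [Nat.add_sub_cancel] at hR hL
  have hRz : ((x : ℤ) + w) * z + z * A ≤ 10 * (A + 1) ^ 2 := by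
    zify at hR; linarith [hR]
  have hLz : ((z : ℤ) + w) * x + x * A ≤ 10 * (A + 1) ^ 2 := by
    zify at hL; linarith [hL]
  have hVz : 10 * ((A : ℤ) + 1) ^ 3 + 3 * (A + 1) + 1 ≤ x * (w + 1) * z + 3 * (A + 1) ^ 2 := by
    zify at hfl; linarith [hfl]
  have hA : (132 : ℤ) ≤ A := by exact_mod_cast (by omega : 132 ≤ A)
  rcases le_total x z with hxz | hzx
  · exact arith_core_all (by exact_mod_cast hx1) (by positivity) (by exact_mod_cast hxz) hA hRz hVz
  · exact arith_core_all (by exact_mod_cast hz1) (by positivity) (by exact_mod_cast hzx) hA hLz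
      (by linarith [hVz])

end SemiregularEleven
end Summit.MatrixMultiplication.MatrixMultiplication.Theorems.SubgroupIdentityDesigns.Negative

end
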